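import Literature.MathematicalPhysics.QuantumFieldTheory.Balaban1983to89.B9SupplySockB9P3ZdAtHermInAk
import Literature.MathematicalPhysics.QuantumFieldTheory.Balaban1983to89.B9Eq326DeltaAHermitianZd
import Literature.MathematicalPhysics.QuantumFieldTheory.Balaban1983to89.T4TermwiseTorus

/-!
# `Balaban1983to89.B9Eq327GreenZdHermPer` — [Balaban1985BackgroundPropagators] (3.27) `G(U) = (Δ_a)⁻¹` ON THE TORUS `T_η` READ ON `ℤᵈ`:
# the propagator letter `G_𝔤(U₀)` of the J-N06→N05 junction on the `P`-PERIODIC HERMITIAN bond fields — the periodic twin of `B9Eq327GreenZdHerm`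
# (carrier `domSubHPer P`, regularity predicate `RegularAtHPer`, the object `gopZdHPer`, the record edit `withGopZdHPer`, the periodic-guarded binder
# `InvAtHIPer` and its supplier, positivity ⟹ regularity on the period cell, the periodic `D*D` energy identity, and an A6 witness)

statement-level skeleton of published theorems with citation tags; proofs where landed; nothing here is a claim about the
Yang–Mills mass gap

`[Balaban1985BackgroundPropagators]` ("B9", CMP **99** (1985) 389–434): p. 391 (*«values in N × N hermitian matrices»*, *«X·Y = tr XY»*), (3.4) p. 391,
(3.10) p. 392, (3.26)–(3.27) p. 395 (*«Δ_a = Δ + DRD* + Q*aQ … G(U) = G = (Δ_a↾Ω₀)⁻¹ = (Ω₀Δ_aΩ₀)⁻¹»*), Thm 3.11 p. 416 (*«the operators Δ′_a, G′, …, Δ_a, G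
are positive definite … uniformly in U, Ω_j»*).  `[Balaban1985RegularSpaces]` ("B8", CMP **99** (1985) 75–102): p. 77 (*«Let us consider a sequence of
domains Ω₀ ⊃ Ω₁ ⊃ … ⊃ Ω_k … we admit the case when some domains Ω_j are equal to T_η»*; bond convention), (1.7) p. 77, (1.33) p. 82, (1.55), (1.58) p. 86
(*«A = G(U₀)J − … where the operator G(U₀) was introduced and investigated in [4]»*).  `[Balaban1985Averaging]` (4) p. 18 (the finite torus `T_η`).
PDF held: `paper:balaban1985-cmp99-background-propagators` pp. 391–396, 416; `paper:balaban1985-cmp99-regular-spaces-gauge-fixing` pp. 77, 86.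

CITATION HEADER ∕ WHY THIS FILE (cell `pub-ymgap`, YM Track A, HUMAN RULING D-0062; DAG node N06 = [B9]; seat `pub-ymgap-dag-n06-b` (g22), the
junction ∕ letter lineage of J-N06→N05 and author of the Hermitian object `B9Eq327GreenZdHerm.gopZdH` (g18)).  Director-ym №217 (1) ∕ plan g86
PENS-217 adopted the **(β′-PERIODIC) road** behind the [B8] display: N05's family index forces `Ω 0 = univ` (`Node00.CarriersB8.IdxB8`; [B8] Thm 2 is
boundary-refuted at every `Ω₀ ⊊ ℤᵈ`, dag-n05-a), while N06's objects `gopZd ∕ gopZdH ∕ projE` are finite-dimensional linear algebra needing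
`(Ω 0).Finite` — so the junction cannot close on `ℤᵈ` members as typed (dag-n05-d JUNCTION ROAD NOTE v2).  Print's own carrier is the FINITE torus
`T_η` ([B8] p. 77), read on `ℤᵈ` as `P`-PERIODIC data (dag-n05-c P1 `B8LeafModelZdPer.zdGF3Per`: periodic `Cfg ∕ GT ∕ Src` subtypes, `Ω 0 = univ`
KEPT).  The plan's word for the N06 side: *«(β′) asks `gopZd ∕ projE` on the periodic subspace with `Module.Finite` in place of `(Ω 0).Finite` — N06's
lane order»*.  THIS FILE is that object for the Hermitian propagator: every construction of `B9Eq327GreenZdHerm` re-done on the real subspace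
`E_𝔤^per(P)` of `P`-periodic Hermitian bond fields on ALL of `ℤᵈ` (finite-dimensional for `P ≥ 1` and a finite-dimensional fibre — the torus
`(ℤ∕P)ᵈ`), with the periodicity predicate `T4TermwiseTorus.IsPeriodic P` of P1 and the period cell `T4TermwiseTorus.box P = [0, P)ᵈ`.  Nothing of
`B9Eq327GreenZd ∕ …Herm` is restated: `domSub ∕ deltaAOf ∕ LinearOnDomAt ∕ opsLevelZero ∕ hermPart` are imported BY NAME.

WHAT IS DECLARED ∕ PROVED (kernel, 0 sorry; definitions with bodies + theorems; no `instance`, no `notation`).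
* §1 CARRIER: ★ `domSubHPer P` (`E_𝔤^per(P)`: `P`-periodic Hermitian bond fields, a real subspace) · `mem_domSubHPer_iff` · `bondTouches_univ`,
  `mem_domSub_univ`, `domSubHPer_le_domSubH_univ`, `deltaADom_univ` (at `Ω₀ = ℤᵈ`: `E(ℤᵈ)` = all bond fields, `Δ_a↾Ω₀ = Δ_a`) · `tcls_sub`,
  `isPeriodic_tlift_tcls`, `apply_tlift_tcls_of_isPeriodic` · ★ `finiteDimensional_domSubHPer` (`P ≠ 0`, f.d. fibre: restriction to the cell `[0,P)ᵈ`
  is injective) · `restrictLinHPer P` (`J ↦ hermPart ∘ J ∘ (tlift ∘ tcls P)`: ℝ-linear INTO the carrier) · `restrictLinHPer_coe_apply`,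
  `restrictLinHPer_coe_of_mem ∕ _of_mem` (the identity on the carrier).
* §2 OBJECT: ★ `RegularAtHPer η o P U₀` («`Δ_a(U₀)` agrees on `E_𝔤^per(P)` with an INVERTIBLE ℝ-linear operator OF `E_𝔤^per(P)`» — Thm 3.11's
  conclusion on the torus, qualitative, a `Prop`) · `deltaAEquivHPer ∕ _coe` · ★ `gopZdHPer η o P U₀ J` (`G_𝔤^per(U₀) := (Δ_a↾E_𝔤^per)⁻¹ ∘ restrictLinHPer`,
  total; `0` off the regime) · `gopZdHPer_of_regularAtHPer ∕ _of_not_regularAtHPer ∕ _add ∕ _mem_domSubHPer` · ★★ `gopZdHPer_apply_eq_of_regularAtHPer`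
  ((3.27) as (1.58) uses it: `G_𝔤^per(U₀)J = A` for `A ∈ E_𝔤^per(P)` and `J = Δ_a(U₀)A`).
* §3 RECORD ∕ BINDER: `withGopZdHPer P ops` (`withGopZdHPer_Gop ∕ _Dp ∕ _DRDs ∕ _QQ`, `deltaAOf_withGopZdHPer` — `rfl`) · ★ `gopAddAt_withGopZdHPer`
  (`GopAddAt`, no hypothesis) · ★ `InvAtHIPer P L ops aI M i m` (= `B9SupplySockB9P3ZdAtHermInAk.InvAtHI` VERBATIM with two guards `IsPeriodic P U₀`,
  `IsPeriodic P A`) · `invAtHIPer_anti` · `invAtHIPer_of_invAtHI` · `RegularInClassAtHPer` (Thm 3.11 at the member on the torus, keyed by the datum's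
  class (1.7): a `Prop`) · `regularInClassAtHPer_anti` · ★★ `invAtHIPer_withGopZdHPer` (`i.Ω 0 = univ`: `RegularInClassAtHPer ⟹ InvAtHIPer P L
  (withGopZdHPer P ops) aI M i m`).
* §4 POSITIVITY ⟹ REGULARITY: `bondPairPer τ P A J = Σ_μ Σ_{x ∈ [0,P)ᵈ} Re τ(A(x,μ)* J(x,μ))` · `bondPairPer_zero_right` · `PerPreservingAt η o P U₀`
  (`Δ_a(U₀)` maps `E_𝔤^per(P)` into itself — a `Prop` on the record's letters) · ★★ `regularAtHPer_of_bondPairPer_pos` (`P ≠ 0`, f.d. fibre: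
  `LinearOnDomAt η o univ U₀` + `PerPreservingAt` + `0 < ⟨A, Δ_a(U₀)A⟩_{τ,per}` on `E_𝔤^per(P) ∖ 0` ⟹ `RegularAtHPer` — positive ⟹ injective ⟹ bijective).
* §5 PERIODIC BOND CALCULUS (summation by parts on the torus cell): `isPeriodic_apply_dir ∕ _comp_add ∕ _comp_sub ∕ _finset_sum` (bookkeeping) ·
  `isPeriodic_covDerivFwd ∕ _covDeriv ∕ _plaqCovDeriv ∕ _Jcur_dir ∕ _Jcur`, `Jcur_add_period` (translation covariance of the stencils (1.1), (3.4), (1.55)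
  at periodic data) · ★ `sum_box_shift` (`Σ_{x∈[0,P)ᵈ} g(x + t) = Σ_{x∈[0,P)ᵈ} g(x)` for periodic `g`) ·
  ★ `sum_box_pair_covDerivFwd ∕ _left` (`D^{η*}_{U₀,μ}` is the `B`-transpose of `D^η_{U₀,μ}` on the cell, for every `Ad`-invariant pairing `B`) ·
  ★★ `sum_box_pair_Jcur` (THE ENERGY IDENTITY ON THE TORUS: `Σ_κ Σ_cell B(A_κ, (D*DA)_κ) = Σ_{ν<κ} Σ_cell B((D^ηA)_{νκ}, (D^ηA)_{νκ})` — the periodic twin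
  of dag-n06-w4's `B9Eq326GaugeTermSquareZd.sum_finsum_pair_Jcur`) · ★ `sum_box_re_trace_Jcur_nonneg` (`⟨A, D*DA⟩_{τ,per} ≥ 0` at a periodic unitary `U₀`).
* §6 A6 ∕ NON-VACUITY at `Ω 0 = univ` members for dag-n06-w4's one-level record `B9Eq327GreenZd.opsLevelZero` (`Δ_a = D*D + η⁻²`):
  `perPreservingAt_opsLevelZero`, `bondPairPer_self_pos`, ★ `bondPairPer_deltaAOf_opsLevelZero_pos`, ★ `regularAtHPer_opsLevelZero` (EVERY periodic
  unitary `U₀`), `regularInClassAtHPer_opsLevelZero`, ★ `invAtHIPer_withGopZdHPer_opsLevelZero` — the hypothesis of §3 and its conclusion are inhabited.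

HONEST SCOPE.  (i) OBJECTS + bookkeeping + one lattice identity; Theorem 3.11 ∕ 3.3 are NOT proved: `RegularInClassAtHPer` is a DISPLAYED `Prop`
whose content is print's Thm 3.11 at the member (on the torus); the estimates (3.42)–(3.47) uniform in the torus size `P` — N06's node content —
are untouched.  (ii) NOT in this file (other hands ∕ later files): the periodic twins of dag-n06-w4's Landau projection `projE ∕ opsLandau` (the
`DRD*` letter on the periodic subspace), and the periodicity ∕ Hermiticity preservation of the genuine record `opsAllZd`'s letters `Δ′ = DpZd`,
`Q*aQ = QQZdP` (under `Lʲ ∣ P`) — so `PerPreservingAt` is inhabited here only for the one-level record.  (iii) READING: `IsPeriodic P F :=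
∀ x m, F (x + P•m) = F x` (P1's predicate); `P = 0` is allowed by the types (then the carrier is all Hermitian bond fields and §1's finiteness ∕ §4–§6
do not apply: they take `[NeZero P]`); `G_𝔤^per` reads a general `J` through `hermPart ∘ J ∘ (representative in [0,P)ᵈ)`, which is `J` itself on the
carrier; outside the regime the letter is `0`.  (iv) `τ` is a PARAMETER with displayed properties (tracial, faithful), as in the lineage.  (v)
Count-neutral; N05 ∕ N06 NOT discharged; K1⁹ `stmt-QuantumFields-27364` NOT closed; 28∕28 · 5∕27 UNMOVED; one finite `𝕋⁴` programme at fixed `ε`,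
Bałaban as printed; R4 closes only the conditional finite-`𝕋⁴` rung `BalabanLadder.UV` — nothing continuum ∕ ℝ⁴ ∕ OS ∕ mass gap ∕ Clay.  Unit
`pub-ymgap-dag-n06-b` (g22), 2026-08-28.
-/

noncomputable section

namespace Literature.MathematicalPhysics.QuantumFieldTheory.Balaban1983to89.B9Eq327GreenZdHermPer

open B7Prop1Explicit B7Eq78Linearization
open B7Prop2Explicit (unitaryUnits)
open B8Ineq132 (BondTouches covDeriv covDerivFwd InAk)
open B8Eq146AExpansion (plaqCovDeriv)
open B8Eq155JBound (Jcur)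
open B8LeafModelZd (ZdIdx)
open B9SupplySockB9P3ZdLetters (OpsZd deltaAOf)
open B9SupplySockB9P3ZdLettersOmega (OnDom restrictDom restrictDom_of restrictDom_of_not)
open B9SupplySockB9P3ZdAt (GopAddAt)
open B9SupplySockB9P3ZdAtHermInAk (InvAtHI)
open B9Eq327GreenZd (domSub deltaADom LinearOnDomAt opsLevelZero deltaAOf_opsLevelZero linearOnDomAt_opsLevelZero)
open B9Eq327GreenZdHerm (hermPart hermPart_of_isSelfAdjoint isSelfAdjoint_hermPart hermPart_add hermPart_smul domSubH)
open B9Eq326GaugeTermSquareZd (re_trace_star_pair_invariant)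
open B9Eq326DeltaAHermitianZd (star_Jcur)
open T4TermwiseTorus (IsPeriodic box tcls tlift tcls_add tcls_period tcls_tlift tlift_mem_box tlift_tcls_of_mem_box)

-- `Site` alone could resolve to the torus sites of `Setup.lean`; re-export the `ℤ^d` sites of `B7Prop1Explicit`.
export B7Prop1Explicit (Site)

variable {d : ℕ} {𝔸 : Type*} [CStarAlgebra 𝔸]

/-! ## §1  The periodic Hermitian carrier `E_𝔤^per(P)`: `P`-periodic Hermitian bond fields on `ℤᵈ` (the torus `T_η` read on `ℤᵈ`) -/

section Carrier

variable (P : ℕ)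

/-- ★ **`E_𝔤^per(P)`, THE PERIODIC HERMITIAN CARRIER**: bond fields `ℤᵈ × {directions} → 𝔸` which are `P`-PERIODIC (`F (x + P•m) = F x`: a field on the
torus `(ℤ∕P)ᵈ = T_η` read on the universal cover, [B8] p. 77 «Ω_j = T_η») with HERMITIAN values (print's `𝔤`-valued fields, [B9] p. 391), as a real
subspace of all bond fields.  At `Ω₀ = T_η` there is no Dirichlet condition: every bond touches `Ω₀`.
[cite: Balaban1985BackgroundPropagators, (3.27) p.395, p.391; Balaban1985RegularSpaces, p.77 («we admit the case when some domains Ω_j are equal to T_η»); Balaban1985Averaging, (4) p.18] -/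
def domSubHPer : Submodule ℝ (Site d → Fin d → 𝔸) where
  carrier := {A | IsPeriodic P A ∧ ∀ (y : Site d) (τ : Fin d), IsSelfAdjoint (A y τ)}
  add_mem' := by
    rintro A B ⟨hA, hA'⟩ ⟨hB, hB'⟩
    refine ⟨fun x m => ?_, fun y τ => (hA' y τ).add (hB' y τ)⟩
    rw [Pi.add_apply, Pi.add_apply, hA x m, hB x m]
  zero_mem' := ⟨fun _ _ => rfl, fun _ _ => IsSelfAdjoint.zero _⟩
  smul_mem' := by
    rintro c A ⟨hA, hA'⟩
    refine ⟨fun x m => ?_, fun y τ => ?_⟩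
    · rw [Pi.smul_apply, Pi.smul_apply, hA x m]
    · rw [Pi.smul_apply, Pi.smul_apply, IsSelfAdjoint, star_smul, star_trivial, (hA' y τ).star_eq]

/-- membership, unfolded. [cite: Balaban1985BackgroundPropagators, (3.27) p.395 (bookkeeping)] -/
theorem mem_domSubHPer_iff (A : Site d → Fin d → 𝔸) :
    A ∈ domSubHPer (d := d) (𝔸 := 𝔸) P ↔ IsPeriodic P A ∧ ∀ (y : Site d) (τ : Fin d), IsSelfAdjoint (A y τ) := Iff.rfl

omit [CStarAlgebra 𝔸] in
/-- **AT `Ω₀ = T_η` (read `Ω₀ = ℤᵈ`) EVERY BOND TOUCHES `Ω₀`.** [cite: Balaban1985RegularSpaces, p.77 (bond convention; «Ω_j = T_η»)] -/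
theorem bondTouches_univ (y : Site d) (τ : Fin d) : BondTouches (Set.univ : Set (Site d)) y τ := Or.inl (Set.mem_univ y)

/-- at `Ω₀ = ℤᵈ` the field class `E(Ω₀)` of `B9Eq327GreenZd` is ALL bond fields. [cite: Balaban1985BackgroundPropagators, (3.27) p.395] -/
theorem mem_domSub_univ (A : Site d → Fin d → 𝔸) : A ∈ domSub (𝔸 := 𝔸) (Set.univ : Set (Site d)) :=
  fun y τ h => absurd (bondTouches_univ y τ) h

/-- `E_𝔤^per(P) ≤ E_𝔤(ℤᵈ)` (the lineage's Hermitian carrier at `Ω₀ = univ`). [cite: Balaban1985BackgroundPropagators, (3.27) p.395, p.391] -/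
theorem domSubHPer_le_domSubH_univ : domSubHPer (d := d) (𝔸 := 𝔸) P ≤ domSubH (𝔸 := 𝔸) (Set.univ : Set (Site d)) :=
  fun A hA => ⟨mem_domSub_univ A, hA.2⟩

/-- **AT `Ω₀ = ℤᵈ`, `Δ_a↾Ω₀ = Δ_a`** (the Dirichlet restriction `𝟙_{Ω₀}` of `B9Eq327GreenZd.deltaADom` is the identity).
[cite: Balaban1985BackgroundPropagators, (3.26)–(3.27) p.395] -/
theorem deltaADom_univ (η : ℝ) (o : OpsZd d 𝔸) (U₀ : Site d → Fin d → 𝔸ˣ) (A : Site d → Fin d → 𝔸) :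
    deltaADom η o (Set.univ : Set (Site d)) U₀ A = deltaAOf η o U₀ A := by
  funext y τ
  exact restrictDom_of _ (bondTouches_univ y τ)

omit [CStarAlgebra 𝔸] in
/-- torus classes are subtractive: `[x − y] = [x] − [y]` (reading `T_η` on `ℤᵈ`; bookkeeping). [cite: Balaban1985RegularSpaces, p.77 («Ω_j = T_η»; bookkeeping)] -/
theorem tcls_sub (x y : Site d) : tcls P (x - y) = tcls P x - tcls P y :=
  eq_sub_of_add_eq (by rw [← tcls_add, sub_add_cancel])

omit [CStarAlgebra 𝔸] in
/-- the representative map `x ↦ tlift [x]` into the cell `[0,P)ᵈ` is itself `P`-periodic. [cite: Balaban1985RegularSpaces, p.77 («Ω_j = T_η»)] -/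
theorem isPeriodic_tlift_tcls : IsPeriodic P fun x : Site d => tlift (tcls P x) := fun x m => by
  simp only [tcls_add, tcls_period, add_zero]

omit [CStarAlgebra 𝔸] in
/-- a `P`-periodic field factors through the representative in `[0,P)ᵈ`: `F (tlift [x]) = F x`. [cite: Balaban1985RegularSpaces, p.77 («Ω_j = T_η»)] -/
theorem apply_tlift_tcls_of_isPeriodic [NeZero P] {β : Sort*} {F : Site d → β} (hF : IsPeriodic P F) (x : Site d) : F (tlift (tcls P x)) = F x :=
  hF.apply_tlift x

/-- ★ **`E_𝔤^per(P)` IS FINITE-DIMENSIONAL** over `ℝ` (`P ≠ 0`, finite-dimensional fibre): a periodic field is determined by its values on the finitely many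
bonds of the cell `[0,P)ᵈ` — «`Module.Finite` in place of `(Ω 0).Finite`», the torus `T_η` is finite.
[cite: Balaban1985BackgroundPropagators, (3.27) p.395 («(Ω₀Δ_aΩ₀)⁻¹» — a finite matrix on the torus); Balaban1985RegularSpaces, p.77] -/
theorem finiteDimensional_domSubHPer [FiniteDimensional ℝ 𝔸] [NeZero P] : FiniteDimensional ℝ (domSubHPer (d := d) (𝔸 := 𝔸) P) := by
  let res : domSubHPer (d := d) (𝔸 := 𝔸) P →ₗ[ℝ] (↥(box (d := d) P) → Fin d → 𝔸) :=
    { toFun := fun A x => (A : Site d → Fin d → 𝔸) x.1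
      map_add' := fun A B => rfl
      map_smul' := fun c A => rfl }
  refine FiniteDimensional.of_injective res fun A B h => ?_
  apply Subtype.ext
  funext y
  have hy := congr_fun h ⟨tlift (tcls P y), tlift_mem_box _⟩
  change (A : Site d → Fin d → 𝔸) (tlift (tcls P y)) = (B : Site d → Fin d → 𝔸) (tlift (tcls P y)) at hy
  rwa [apply_tlift_tcls_of_isPeriodic P A.2.1, apply_tlift_tcls_of_isPeriodic P B.2.1] at hy

/-- **`J ↦ hermPart ∘ J ∘ (representative in [0,P)ᵈ)`, A LINEAR MAP INTO `E_𝔤^per(P)`** — the periodic reading of the lineage's `restrictLinH` («`𝟙_{Ω₀}` then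
the Hermitian part»): the value at `x` is the Hermitian part of `J` at the representative of `x`'s torus class; on the carrier it is the identity
(`restrictLinHPer_coe_of_mem`).  Used only to make `G_𝔤^per` total and additive in `J`. [cite: Balaban1985BackgroundPropagators, (3.27) p.395, p.391] -/
def restrictLinHPer : (Site d → Fin d → 𝔸) →ₗ[ℝ] domSubHPer (d := d) (𝔸 := 𝔸) P where
  toFun J := ⟨fun x τ => hermPart (J (tlift (tcls P x)) τ),
    ⟨fun x m => by simp only [tcls_add, tcls_period, add_zero], fun x τ => isSelfAdjoint_hermPart _⟩⟩
  map_add' J₁ J₂ := by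
    apply Subtype.ext; funext x τ
    simp only [Pi.add_apply, Submodule.coe_add, hermPart_add]
  map_smul' c J := by
    apply Subtype.ext; funext x τ
    simp only [Pi.smul_apply, RingHom.id_apply, Submodule.coe_smul, hermPart_smul]

/-- `restrictLinHPer`, unfolded at a bond. [cite: Balaban1985BackgroundPropagators, (3.27) p.395 (bookkeeping)] -/
theorem restrictLinHPer_coe_apply (J : Site d → Fin d → 𝔸) (x : Site d) (τ : Fin d) :
    (restrictLinHPer (d := d) (𝔸 := 𝔸) P J : Site d → Fin d → 𝔸) x τ = hermPart (J (tlift (tcls P x)) τ) := rfl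

/-- **ON THE CARRIER `restrictLinHPer` IS THE IDENTITY** (`P ≠ 0`): a periodic Hermitian `J` is returned unchanged.
[cite: Balaban1985BackgroundPropagators, (3.27) p.395 (bookkeeping)] -/
theorem restrictLinHPer_coe_of_mem [NeZero P] {J : Site d → Fin d → 𝔸} (hJ : J ∈ domSubHPer (d := d) (𝔸 := 𝔸) P) :
    (restrictLinHPer (d := d) (𝔸 := 𝔸) P J : Site d → Fin d → 𝔸) = J := by
  funext x τ
  rw [restrictLinHPer_coe_apply, apply_tlift_tcls_of_isPeriodic P hJ.1, hermPart_of_isSelfAdjoint (hJ.2 x τ)]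

/-- `restrictLinHPer` of a member of the carrier is that member. [cite: Balaban1985BackgroundPropagators, (3.27) p.395 (bookkeeping)] -/
theorem restrictLinHPer_of_mem [NeZero P] (A : domSubHPer (d := d) (𝔸 := 𝔸) P) :
    restrictLinHPer (d := d) (𝔸 := 𝔸) P (A : Site d → Fin d → 𝔸) = A :=
  Subtype.ext (restrictLinHPer_coe_of_mem P A.2)

end Carrier

/-! ## §2  Regularity on the torus and the propagator `G_𝔤^per(U₀) = (Δ_a↾E_𝔤^per(P))⁻¹` -/

section Green

variable (η : ℝ) (o : OpsZd d 𝔸) (P : ℕ) (U₀ : Site d → Fin d → 𝔸ˣ)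

/-- ★ **THEOREM 3.11's CONCLUSION ON THE TORUS, qualitative**: «`Δ_a(U₀)` (the record's four-letter operator `deltaAOf`, (3.26)) agrees on `E_𝔤^per(P)`
with an INVERTIBLE ℝ-linear operator of `E_𝔤^per(P)`» — so that `G(U₀) = (Δ_a)⁻¹` of (3.27) exists on the torus `T_η` read as `P`-periodic data.  A
`Prop` the consumer supplies (print: Thm 3.11 for `U₀` in the class (3.35); [B8] uses it at `U₀ ∈ 𝔄_k({Ω_j}, α₀)`, (1.33)).  Meaningful for a periodic
`U₀` and a record whose letters preserve periodic Hermitian fields (`PerPreservingAt`, §4).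
[cite: Balaban1985BackgroundPropagators, Thm 3.11 p.416, (3.26)–(3.27) p.395, p.391; Balaban1985RegularSpaces, p.77, (1.33) p.82] -/
def RegularAtHPer (η : ℝ) (o : OpsZd d 𝔸) (P : ℕ) (U₀ : Site d → Fin d → 𝔸ˣ) : Prop :=
  ∃ Φ : domSubHPer (d := d) (𝔸 := 𝔸) P →ₗ[ℝ] domSubHPer (d := d) (𝔸 := 𝔸) P,
    (∀ A : domSubHPer (d := d) (𝔸 := 𝔸) P, (Φ A : Site d → Fin d → 𝔸) = deltaAOf η o U₀ A) ∧ Function.Bijective Φ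

/-- the invertible operator of `RegularAtHPer`, as a linear equivalence of `E_𝔤^per(P)`. [cite: Balaban1985BackgroundPropagators, (3.27) p.395] -/
def deltaAEquivHPer (h : RegularAtHPer η o P U₀) : domSubHPer (d := d) (𝔸 := 𝔸) P ≃ₗ[ℝ] domSubHPer (d := d) (𝔸 := 𝔸) P :=
  LinearEquiv.ofBijective (Classical.choose h) (Classical.choose_spec h).2

/-- the equivalence acts as `Δ_a(U₀)`. [cite: Balaban1985BackgroundPropagators, (3.26)–(3.27) p.395 (bookkeeping)] -/
theorem deltaAEquivHPer_coe (h : RegularAtHPer η o P U₀) (A : domSubHPer (d := d) (𝔸 := 𝔸) P) :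
    (deltaAEquivHPer η o P U₀ h A : Site d → Fin d → 𝔸) = deltaAOf η o U₀ A := by
  rw [deltaAEquivHPer, LinearEquiv.ofBijective_apply]
  exact (Classical.choose_spec h).1 A

open Classical in
/-- ★ **`G_𝔤^per(U₀) = (Δ_a)⁻¹` ON THE TORUS READ ON `ℤᵈ`** ((3.27) at `Ω₀ = T_η`): on a bond field `J`, read `J` into `E_𝔤^per(P)` by `restrictLinHPer`
(the identity on periodic Hermitian `J`) and apply the inverse of `Δ_a(U₀)↾E_𝔤^per(P)` — when `RegularAtHPer` (Theorem 3.11's regime); `0` otherwise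
(no claim there).  Built from WHATEVER co-letters `Dp ∕ DRDs ∕ QQ` the record `o` carries.
[cite: Balaban1985BackgroundPropagators, (3.27) p.395, Thm 3.11 p.416, p.391; Balaban1985RegularSpaces, (1.58) p.86, p.77] -/
def gopZdHPer (J : Site d → Fin d → 𝔸) : Site d → Fin d → 𝔸 :=
  if h : RegularAtHPer η o P U₀ then ((deltaAEquivHPer η o P U₀ h).symm (restrictLinHPer P J) : domSubHPer (d := d) (𝔸 := 𝔸) P) else 0

/-- `G_𝔤^per` in the regime. [cite: Balaban1985BackgroundPropagators, (3.27) p.395 (bookkeeping)] -/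
theorem gopZdHPer_of_regularAtHPer (h : RegularAtHPer η o P U₀) (J : Site d → Fin d → 𝔸) :
    gopZdHPer η o P U₀ J = ((deltaAEquivHPer η o P U₀ h).symm (restrictLinHPer P J) : domSubHPer (d := d) (𝔸 := 𝔸) P) := by
  rw [gopZdHPer, dif_pos h]

/-- `G_𝔤^per = 0` outside the regime (no claim). [cite: Balaban1985BackgroundPropagators, (3.27) p.395 (bookkeeping)] -/
theorem gopZdHPer_of_not_regularAtHPer (h : ¬ RegularAtHPer η o P U₀) (J : Site d → Fin d → 𝔸) : gopZdHPer η o P U₀ J = 0 := by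
  rw [gopZdHPer, dif_neg h]

/-- **`G_𝔤^per` IS ADDITIVE IN `J`, ALWAYS.** [cite: Balaban1985BackgroundPropagators, (3.27) p.395] -/
theorem gopZdHPer_add (J₁ J₂ : Site d → Fin d → 𝔸) :
    gopZdHPer η o P U₀ (J₁ + J₂) = gopZdHPer η o P U₀ J₁ + gopZdHPer η o P U₀ J₂ := by
  by_cases h : RegularAtHPer η o P U₀
  · rw [gopZdHPer_of_regularAtHPer η o P U₀ h, gopZdHPer_of_regularAtHPer η o P U₀ h, gopZdHPer_of_regularAtHPer η o P U₀ h, map_add,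
      map_add, Submodule.coe_add]
  · rw [gopZdHPer_of_not_regularAtHPer η o P U₀ h, gopZdHPer_of_not_regularAtHPer η o P U₀ h, gopZdHPer_of_not_regularAtHPer η o P U₀ h,
      add_zero]

/-- `G_𝔤^per J ∈ E_𝔤^per(P)` (periodic and Hermitian output, always). [cite: Balaban1985BackgroundPropagators, (3.27) p.395, p.391] -/
theorem gopZdHPer_mem_domSubHPer (J : Site d → Fin d → 𝔸) : gopZdHPer η o P U₀ J ∈ domSubHPer (d := d) (𝔸 := 𝔸) P := by
  by_cases h : RegularAtHPer η o P U₀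
  · rw [gopZdHPer_of_regularAtHPer η o P U₀ h]; exact Submodule.coe_mem _
  · rw [gopZdHPer_of_not_regularAtHPer η o P U₀ h]; exact Submodule.zero_mem _

/-- ★★ **(3.27) ON THE TORUS AS [B8] (1.58) USES IT: `G_𝔤^per(U₀)(Δ_a(U₀)A) = A`** — in the regime `RegularAtHPer`, for `A ∈ E_𝔤^per(P)` and ANY bond field `J`
agreeing with `Δ_a(U₀)A` everywhere (at `Ω₀ = T_η` every bond touches `Ω₀`). [cite: Balaban1985BackgroundPropagators, (3.27) p.395; Balaban1985RegularSpaces, (1.58) p.86, p.77] -/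
theorem gopZdHPer_apply_eq_of_regularAtHPer [NeZero P] (h : RegularAtHPer η o P U₀) {A : Site d → Fin d → 𝔸} (hA : A ∈ domSubHPer (d := d) (𝔸 := 𝔸) P)
    {J : Site d → Fin d → 𝔸} (hJ : ∀ (y : Site d) (τ : Fin d), J y τ = deltaAOf η o U₀ A y τ) :
    gopZdHPer η o P U₀ J = A := by
  rw [gopZdHPer_of_regularAtHPer η o P U₀ h]
  have hΦ := deltaAEquivHPer_coe η o P U₀ h ⟨A, hA⟩
  -- `J = Δ_aA = Φ⟨A⟩` is in the carrier, so `restrictLinHPer` returns it unchanged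
  have hJ' : J = (deltaAEquivHPer η o P U₀ h ⟨A, hA⟩ : Site d → Fin d → 𝔸) := by
    rw [hΦ]; funext y τ; exact hJ y τ
  have hres : restrictLinHPer (d := d) (𝔸 := 𝔸) P J = deltaAEquivHPer η o P U₀ h ⟨A, hA⟩ := by
    rw [hJ']; exact restrictLinHPer_of_mem P _
  rw [hres, LinearEquiv.symm_apply_apply]

end Green

/-! ## §3  The record edit `withGopZdHPer`; the binders `GopAddAt` (proved) and `InvAtHIPer` (from Theorem 3.11 at the member on the torus) -/

section Record

variable {L : ℕ} (P : ℕ)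

/-- **THE LETTER FAMILY WITH `Gop := G_𝔤^per`** at every member `(M, i, m)` — print's `(Δ_a)⁻¹` on the torus of period `P` for the member's `η = i.η` and
the record's OWN co-letters `Dp ∕ DRDs ∕ QQ` (untouched). [cite: Balaban1985BackgroundPropagators, (3.27) p.395, (3.26) p.395] -/
def withGopZdHPer (ops : ℝ → ZdIdx d L → ℕ → OpsZd d 𝔸) : ℝ → ZdIdx d L → ℕ → OpsZd d 𝔸 :=
  fun M i m => { ops M i m with Gop := fun U₀ J => gopZdHPer i.η (ops M i m) P U₀ J }

variable (ops : ℝ → ZdIdx d L → ℕ → OpsZd d 𝔸) (M : ℝ) (i : ZdIdx d L) (m : ℕ)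

/-- the `Gop` field of `withGopZdHPer P ops`, unfolded. [cite: Balaban1985BackgroundPropagators, (3.27) p.395 (bookkeeping)] -/
theorem withGopZdHPer_Gop (U₀ : Site d → Fin d → 𝔸ˣ) (J : Site d → Fin d → 𝔸) :
    (withGopZdHPer P ops M i m).Gop U₀ J = gopZdHPer i.η (ops M i m) P U₀ J := rfl

/-- the `Dp` field is untouched. [cite: Balaban1985BackgroundPropagators, (3.10) p.392] -/
theorem withGopZdHPer_Dp : (withGopZdHPer P ops M i m).Dp = (ops M i m).Dp := rfl

/-- the `DRDs` field is untouched. [cite: Balaban1985BackgroundPropagators, (3.26) p.395] -/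
theorem withGopZdHPer_DRDs : (withGopZdHPer P ops M i m).DRDs = (ops M i m).DRDs := rfl

/-- the `QQ` field is untouched. [cite: Balaban1985BackgroundPropagators, (3.16) p.393] -/
theorem withGopZdHPer_QQ : (withGopZdHPer P ops M i m).QQ = (ops M i m).QQ := rfl

/-- `Δ_a` of the edited record is `Δ_a` of the record (it never reads `Gop`). [cite: Balaban1985BackgroundPropagators, (3.26) p.395] -/
theorem deltaAOf_withGopZdHPer (U₀ : Site d → Fin d → 𝔸ˣ) (A : Site d → Fin d → 𝔸) :
    deltaAOf i.η (withGopZdHPer P ops M i m) U₀ A = deltaAOf i.η (ops M i m) U₀ A := rfl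

/-- ★ **THE BINDER `GopAddAt` HOLDS FOR `withGopZdHPer P ops` AT EVERY MEMBER, WITH NO HYPOTHESIS.** [cite: Balaban1985BackgroundPropagators, (3.27) p.395] -/
theorem gopAddAt_withGopZdHPer : GopAddAt L (withGopZdHPer P ops) M i m := by
  intro U₀ J₁ J₂
  exact gopZdHPer_add i.η (ops M i m) P U₀ J₁ J₂

/-- ★ **THE PERIODIC-GUARDED (3.27) BINDER `InvAtHIPer`** — `B9SupplySockB9P3ZdAtHermInAk.InvAtHI` VERBATIM with two guards added: the background `U₀` and
the field `A` are `P`-PERIODIC (the torus `T_η` of [B8] p. 77 read on `ℤᵈ`; the (β′) member model's configurations ARE periodic by type).  For every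
`α₀ ≤ aI`, every periodic unitary `U₀ ∈ 𝔄_m({Ω_j}, α₀)` (`InAk`, (1.7)), every periodic HERMITIAN `A ∈ E(Ω₀)` (`OnDom`) and every `J` agreeing with
`Δ_a(U₀)A` on the bonds of `Ω₀`: `G(U₀)J = A`. [cite: Balaban1985BackgroundPropagators, (3.27) p.395, Thm 3.11 p.416, p.391; Balaban1985RegularSpaces, p.77, (1.7) p.77, (1.33) p.82, (1.58) p.86] -/
def InvAtHIPer (P : ℕ) (L : ℕ) (ops : ℝ → ZdIdx d L → ℕ → OpsZd d 𝔸) (aI : ℝ) (M : ℝ) (i : ZdIdx d L) (m : ℕ) : Prop :=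
  ∀ (α₀ : ℝ) (U₀ : Site d → Fin d → 𝔸ˣ), (∀ x κ, U₀ x κ ∈ unitaryUnits 𝔸) → IsPeriodic P U₀ → α₀ ≤ aI → InAk L m i.η α₀ i.Ω U₀ →
    ∀ A : Site d → Fin d → 𝔸, IsPeriodic P A → OnDom L m i.η i.Ω A → (∀ (y : Site d) (τ : Fin d), IsSelfAdjoint (A y τ)) →
      ∀ J : Site d → Fin d → 𝔸, (∀ (y : Site d) (τ : Fin d), BondTouches (i.Ω 0) y τ → J y τ = deltaAOf i.η (ops M i m) U₀ A y τ) →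
        (ops M i m).Gop U₀ J = A

/-- `InvAtHIPer` is antitone in the threshold `aI`. [cite: Balaban1985RegularSpaces, (1.7) p.77 (bookkeeping)] -/
theorem invAtHIPer_anti {aI aI' : ℝ} (h : aI' ≤ aI) (hI : InvAtHIPer P L ops aI M i m) : InvAtHIPer P L ops aI' M i m :=
  fun α₀ U₀ hU₀ hper hα hIn A hAp hA hsa J hJ => hI α₀ U₀ hU₀ hper (hα.trans h) hIn A hAp hA hsa J hJ

/-- the unguarded binder implies the guarded one (drop the two periodicity hypotheses). [cite: Balaban1985BackgroundPropagators, (3.27) p.395 (bookkeeping)] -/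
theorem invAtHIPer_of_invAtHI {aI : ℝ} (hI : InvAtHI L ops aI M i m) : InvAtHIPer P L ops aI M i m :=
  fun α₀ U₀ hU₀ _ hα hIn A _ hA hsa J hJ => hI α₀ U₀ hU₀ hα hIn A hA hsa J hJ

/-- **THEOREM 3.11 AT THE MEMBER ON THE TORUS, keyed by the datum's class (1.7)** (qualitative form, for the record's `Δ_a`): at every PERIODIC unitary
background `U₀ ∈ 𝔄_m({Ω_j}, α₀)` with `α₀ ≤ aI`, `Δ_a(U₀)` is invertible on `E_𝔤^per(P)` (`RegularAtHPer`).  A `Prop` the consumer supplies — print's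
Theorem 3.11 («for M ≥ M₀, α₀ ≤ α₀′ and for U satisfying (3.35) the operators … Δ_a, G are positive definite») is its content — NOT proved here.
[cite: Balaban1985BackgroundPropagators, Thm 3.11 p.416, (3.27) p.395; Balaban1985RegularSpaces, (1.7) p.77, (1.33) p.82] -/
def RegularInClassAtHPer (P : ℕ) (L : ℕ) (ops : ℝ → ZdIdx d L → ℕ → OpsZd d 𝔸) (aI : ℝ) (M : ℝ) (i : ZdIdx d L) (m : ℕ) : Prop :=
  ∀ (α₀ : ℝ) (U₀ : Site d → Fin d → 𝔸ˣ), (∀ x κ, U₀ x κ ∈ unitaryUnits 𝔸) → IsPeriodic P U₀ → α₀ ≤ aI → InAk L m i.η α₀ i.Ω U₀ →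
    RegularAtHPer i.η (ops M i m) P U₀

/-- `RegularInClassAtHPer` is antitone in the threshold `aI`. [cite: Balaban1985RegularSpaces, (1.7) p.77 (bookkeeping)] -/
theorem regularInClassAtHPer_anti {aI aI' : ℝ} (h : aI' ≤ aI) (hR : RegularInClassAtHPer P L ops aI M i m) :
    RegularInClassAtHPer P L ops aI' M i m :=
  fun α₀ U₀ hU₀ hper hα hIn => hR α₀ U₀ hU₀ hper (hα.trans h) hIn

/-- ★★ **`InvAtHIPer` FOR `withGopZdHPer P ops` FROM THEOREM 3.11 AT THE MEMBER ON THE TORUS ALONE** (members with `Ω 0 = univ` = `T_η`, `P ≠ 0`): if `Δ_a(U₀)`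
is invertible on `E_𝔤^per(P)` at every periodic unitary `U₀ ∈ 𝔄_m({Ω_j}, α₀)`, `α₀ ≤ aI` (`RegularInClassAtHPer`), then for every periodic Hermitian `A` and
every `J` agreeing with `Δ_a(U₀)A` on the bonds of `Ω₀ = ℤᵈ`, `G_𝔤^per(U₀)J = A` — (3.27) in the form [B8] (1.58) uses it.
[cite: Balaban1985BackgroundPropagators, (3.27) p.395, Thm 3.11 p.416; Balaban1985RegularSpaces, (1.58) p.86, p.77 («Ω_j = T_η»)] -/
theorem invAtHIPer_withGopZdHPer [NeZero P] {aI : ℝ} (hΩ : i.Ω 0 = Set.univ) (hreg : RegularInClassAtHPer P L ops aI M i m) :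
    InvAtHIPer P L (withGopZdHPer P ops) aI M i m := by
  intro α₀ U₀ hU₀ hper hα hIn A hAp _ hsa J hJ
  show gopZdHPer i.η (ops M i m) P U₀ J = A
  refine gopZdHPer_apply_eq_of_regularAtHPer i.η (ops M i m) P U₀ (hreg α₀ U₀ hU₀ hper hα hIn) ⟨hAp, hsa⟩ fun y τ => hJ y τ ?_
  rw [hΩ]
  exact bondTouches_univ y τ

end Record

/-! ## §4  Positivity of `⟨A, Δ_a(U₀)A⟩_{τ,per}` on `E_𝔤^per(P) ∖ 0` gives `RegularAtHPer` (Theorem 3.11 ⟹ (3.27) exists, on the torus) -/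

section Positivity

variable (τ : 𝔸 →ₗ[ℂ] ℂ) (P : ℕ)

/-- **THE PAIRING OF BOND FIELDS ON THE PERIOD CELL** `⟨A, J⟩_{τ,per} = Σ_μ Σ_{x ∈ [0,P)ᵈ} Re τ(A(x,μ)* J(x,μ))` (print's `Σ_{b ⊂ T_η} η^d tr A(b)J(b)` on the
torus with the positive weight dropped; one representative per torus bond). [cite: Balaban1985BackgroundPropagators, (3.17) p.393, p.391 («X·Y = tr XY»); Balaban1985RegularSpaces, p.77] -/
def bondPairPer (A J : Site d → Fin d → 𝔸) : ℝ := ∑ μ : Fin d, ∑ x ∈ box (d := d) P, (τ (star (A x μ) * J x μ)).re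

/-- `⟨A, 0⟩_{τ,per} = 0`. [cite: Balaban1985BackgroundPropagators, (3.17) p.393 (bookkeeping)] -/
theorem bondPairPer_zero_right (A : Site d → Fin d → 𝔸) : bondPairPer τ P A 0 = 0 := by
  simp only [bondPairPer, Pi.zero_apply, mul_zero, map_zero, Complex.zero_re, Finset.sum_const_zero]

/-- **«`Δ_a(U₀)` MAPS `E_𝔤^per(P)` INTO ITSELF»** — a `Prop` on the record's letters at `U₀` (true for print's operator on the torus at a periodic unitary
background: every stencil is translation covariant and preserves Hermiticity; proved below for the one-level record, letter by letter elsewhere).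
[cite: Balaban1985BackgroundPropagators, (3.26) p.395, p.391; Balaban1985RegularSpaces, p.77 («Ω_j = T_η»)] -/
def PerPreservingAt (η : ℝ) (o : OpsZd d 𝔸) (P : ℕ) (U₀ : Site d → Fin d → 𝔸ˣ) : Prop :=
  ∀ A ∈ domSubHPer (d := d) (𝔸 := 𝔸) P, deltaAOf η o U₀ A ∈ domSubHPer (d := d) (𝔸 := 𝔸) P

/-- ★★ **POSITIVITY ON `E_𝔤^per(P)` GIVES `RegularAtHPer`** (`P ≠ 0`, finite-dimensional fibre): if `Δ_a(U₀)` is the restriction of an ℝ-linear map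
(`LinearOnDomAt` at `Ω₀ = ℤᵈ`), maps `E_𝔤^per(P)` into itself, and `0 < ⟨A, Δ_a(U₀)A⟩_{τ,per}` for every `0 ≠ A ∈ E_𝔤^per(P)`, then `Δ_a(U₀)` is an invertible
operator of `E_𝔤^per(P)` — positive ⟹ injective ⟹ (finite dimension) bijective: Theorem 3.11's «Δ_a, G are positive definite» ⟹ (3.27) exists on `T_η`.
[cite: Balaban1985BackgroundPropagators, Thm 3.11 p.416, (3.27) p.395, p.391; Balaban1985RegularSpaces, p.77] -/
theorem regularAtHPer_of_bondPairPer_pos [FiniteDimensional ℝ 𝔸] [NeZero P] {η : ℝ} {o : OpsZd d 𝔸} {U₀ : Site d → Fin d → 𝔸ˣ}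
    (hlin : LinearOnDomAt η o (Set.univ : Set (Site d)) U₀) (hpres : PerPreservingAt η o P U₀)
    (hpos : ∀ A ∈ domSubHPer (d := d) (𝔸 := 𝔸) P, A ≠ 0 → 0 < bondPairPer τ P A (deltaAOf η o U₀ A)) :
    RegularAtHPer η o P U₀ := by
  haveI := finiteDimensional_domSubHPer (d := d) (𝔸 := 𝔸) P
  obtain ⟨T, hT⟩ := hlin
  have hval : ∀ A : domSubHPer (d := d) (𝔸 := 𝔸) P, T A ∈ domSubHPer (d := d) (𝔸 := 𝔸) P := by
    intro A
    rw [hT A (mem_domSub_univ _)]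
    exact hpres A A.2
  let Φ : domSubHPer (d := d) (𝔸 := 𝔸) P →ₗ[ℝ] domSubHPer (d := d) (𝔸 := 𝔸) P :=
    { toFun := fun A => ⟨T A, hval A⟩
      map_add' := fun A B => by
        apply Subtype.ext
        simp only [Submodule.coe_add, map_add]
      map_smul' := fun c A => by
        apply Subtype.ext
        simp only [Submodule.coe_smul, map_smul, RingHom.id_apply] }
  have hΦ : ∀ A : domSubHPer (d := d) (𝔸 := 𝔸) P, (Φ A : Site d → Fin d → 𝔸) = deltaAOf η o U₀ A := fun A => hT A (mem_domSub_univ _)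
  have hinj : Function.Injective Φ := by
    intro A B hAB
    by_contra hne
    have hne' : ((A - B : domSubHPer (d := d) (𝔸 := 𝔸) P) : Site d → Fin d → 𝔸) ≠ 0 := by
      intro h0
      exact hne (sub_eq_zero.1 (Subtype.ext h0))
    have hp := hpos _ (A - B).2 hne'
    have hzero : (Φ (A - B) : Site d → Fin d → 𝔸) = 0 := by rw [map_sub, hAB, sub_self, Submodule.coe_zero]
    rw [← hΦ, hzero, bondPairPer_zero_right] at hp
    exact lt_irrefl _ hp
  exact ⟨Φ, hΦ, hinj, LinearMap.injective_iff_surjective.1 hinj⟩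

end Positivity

/-! ## §5  Periodic bond calculus: translation covariance of the stencils, shift invariance of the cell sum, summation by parts on the torus,
and the `D*D` energy identity on the period cell -/

section PeriodicStencils

variable {P : ℕ} (η : ℝ) {U₀ : Site d → Fin d → 𝔸ˣ}

omit [CStarAlgebra 𝔸] in
/-- a component of a periodic bond field is a periodic site function. [cite: Balaban1985RegularSpaces, p.77 («Ω_j = T_η»)] -/
theorem isPeriodic_apply_dir {β : Type*} {A : Site d → Fin d → β} (hA : IsPeriodic P A) (κ : Fin d) : IsPeriodic P fun y => A y κ :=
  fun x m => congrFun (hA x m) κ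

omit [CStarAlgebra 𝔸] in
/-- a translate of a periodic site function is periodic. [cite: Balaban1985RegularSpaces, p.77 («Ω_j = T_η»)] -/
theorem isPeriodic_comp_add {β : Sort*} {F : Site d → β} (hF : IsPeriodic P F) (t : Site d) : IsPeriodic P fun x => F (x + t) :=
  fun x m => by
    show F (x + (P : ℤ) • m + t) = F (x + t)
    rw [add_right_comm]; exact hF (x + t) m

omit [CStarAlgebra 𝔸] in
/-- … and so is a translate by `−t`. [cite: Balaban1985RegularSpaces, p.77 («Ω_j = T_η»)] -/
theorem isPeriodic_comp_sub {β : Sort*} {F : Site d → β} (hF : IsPeriodic P F) (t : Site d) : IsPeriodic P fun x => F (x - t) :=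
  fun x m => by
    show F (x + (P : ℤ) • m - t) = F (x - t)
    rw [add_sub_right_comm]; exact hF (x - t) m

omit [CStarAlgebra 𝔸] in
/-- a finite sum of periodic functions is periodic (fields on `T_η` read on `ℤᵈ`; bookkeeping). [cite: Balaban1985RegularSpaces, p.77 («Ω_j = T_η»; bookkeeping)] -/
theorem isPeriodic_finset_sum {ι : Type*} {M : Type*} [AddCommMonoid M] (s : Finset ι) {G : ι → Site d → M}
    (hG : ∀ ν ∈ s, IsPeriodic P (G ν)) : IsPeriodic P fun x => ∑ ν ∈ s, G ν x :=
  fun x m => Finset.sum_congr rfl fun ν hν => hG ν hν x m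

/-- **(1.1) AT PERIODIC DATA IS PERIODIC**: `D^η_{U₀,μ}F` of a periodic `F` at a periodic `U₀`. [cite: Balaban1985RegularSpaces, (1.1) p.76, p.77 («Ω_j = T_η»)] -/
theorem isPeriodic_covDerivFwd (hU : IsPeriodic P U₀) (μ : Fin d) {F : Site d → 𝔸} (hF : IsPeriodic P F) :
    IsPeriodic P (covDerivFwd η U₀ μ F) := fun x m => by
  simp only [covDerivFwd]
  rw [add_right_comm, hF (x + e μ) m, hF x m, show U₀ (x + (P : ℤ) • m) μ = U₀ x μ from congrFun (hU x m) μ]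

/-- **(1.2) AT PERIODIC DATA IS PERIODIC**: the backward derivative `D^{η*}_{U₀,ν}F` entering `D^{η*}`. [cite: Balaban1985RegularSpaces, (1.2) p.76, p.77 («Ω_j = T_η»)] -/
theorem isPeriodic_covDeriv (hU : IsPeriodic P U₀) (ν : Fin d) {F : Site d → 𝔸} (hF : IsPeriodic P F) :
    IsPeriodic P (covDeriv η U₀ ν F) := fun x m => by
  simp only [covDeriv]
  rw [add_sub_right_comm, hF (x - e ν) m, hF x m, show U₀ (x - e ν + (P : ℤ) • m) ν = U₀ (x - e ν) ν from congrFun (hU (x - e ν) m) ν]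

/-- **(3.4) AT PERIODIC DATA IS PERIODIC**: the plaquette covariant derivative `(D^η_{U₀}A)_{μν}`. [cite: Balaban1985BackgroundPropagators, (3.4) p.391; Balaban1985RegularSpaces, p.77] -/
theorem isPeriodic_plaqCovDeriv (hU : IsPeriodic P U₀) {A : Site d → Fin d → 𝔸} (hA : IsPeriodic P A) (μ ν : Fin d) :
    IsPeriodic P (plaqCovDeriv η U₀ A μ ν) := fun x m => by
  rw [B8Eq146AExpansion.plaqCovDeriv_eq_covDerivFwd, B8Eq146AExpansion.plaqCovDeriv_eq_covDerivFwd,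
    isPeriodic_covDerivFwd η hU μ (isPeriodic_apply_dir hA ν) x m, isPeriodic_covDerivFwd η hU ν (isPeriodic_apply_dir hA μ) x m]

/-- **B8's CURRENT `J = D^{η*}_{U₀}D^η_{U₀}A` ((1.55), the `D*D` part of (3.10)) AT PERIODIC DATA IS PERIODIC**, direction by direction.
[cite: Balaban1985RegularSpaces, (1.55) p.86, p.77 («Ω_j = T_η»); Balaban1985BackgroundPropagators, (3.10) p.392] -/
theorem isPeriodic_Jcur_dir (hU : IsPeriodic P U₀) {A : Site d → Fin d → 𝔸} (hA : IsPeriodic P A) (κ : Fin d) :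
    IsPeriodic P fun x => Jcur η U₀ A κ x := by
  have hJ : ∀ x, Jcur η U₀ A κ x =
      ∑ ν ∈ Finset.Iio κ, covDeriv η U₀ ν (plaqCovDeriv η U₀ A ν κ) x - ∑ ν ∈ Finset.Ioi κ, covDeriv η U₀ ν (plaqCovDeriv η U₀ A κ ν) x :=
    fun x => rfl
  intro x m
  show Jcur η U₀ A κ (x + (P : ℤ) • m) = Jcur η U₀ A κ x
  rw [hJ, hJ]
  exact congrArg₂ (· - ·) (Finset.sum_congr rfl fun ν _ => isPeriodic_covDeriv η hU ν (isPeriodic_plaqCovDeriv η hU hA ν κ) x m)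
    (Finset.sum_congr rfl fun ν _ => isPeriodic_covDeriv η hU ν (isPeriodic_plaqCovDeriv η hU hA κ ν) x m)

/-- the same, pointwise: `J_κ(x + P•m) = J_κ(x)`. [cite: Balaban1985RegularSpaces, (1.55) p.86, p.77 («Ω_j = T_η»)] -/
theorem Jcur_add_period (hU : IsPeriodic P U₀) {A : Site d → Fin d → 𝔸} (hA : IsPeriodic P A) (κ : Fin d) (x m : Site d) :
    Jcur η U₀ A κ (x + (P : ℤ) • m) = Jcur η U₀ A κ x :=
  isPeriodic_Jcur_dir η hU hA κ x m

/-- **B8's CURRENT AT PERIODIC DATA IS A PERIODIC BOND FIELD.** [cite: Balaban1985RegularSpaces, (1.55) p.86, p.77 («Ω_j = T_η»)] -/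
theorem isPeriodic_Jcur (hU : IsPeriodic P U₀) {A : Site d → Fin d → 𝔸} (hA : IsPeriodic P A) :
    IsPeriodic P fun x κ => Jcur η U₀ A κ x := fun x m => by
  funext κ
  exact isPeriodic_Jcur_dir η hU hA κ x m

end PeriodicStencils

section CellSum

variable (P : ℕ)

omit [CStarAlgebra 𝔸] in
/-- ★ **THE CELL SUM OF A PERIODIC FUNCTION IS TRANSLATION INVARIANT**: `Σ_{x ∈ [0,P)ᵈ} g(x + t) = Σ_{x ∈ [0,P)ᵈ} g(x)` (`P ≠ 0`) — the sum over the torus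
`(ℤ∕P)ᵈ` does not depend on the fundamental domain (re-index by `x ↦ representative of [x + t]`, a bijection of the cell).
[cite: Balaban1985RegularSpaces, p.77 («Ω_j = T_η»); Balaban1985Averaging, (4) p.18] -/
theorem sum_box_shift [NeZero P] {M : Type*} [AddCommMonoid M] {g : Site d → M} (hg : IsPeriodic P g) (t : Site d) :
    ∑ x ∈ box (d := d) P, g (x + t) = ∑ x ∈ box (d := d) P, g x := by
  refine Finset.sum_nbij' (fun x => tlift (tcls P (x + t))) (fun y => tlift (tcls P (y - t))) (fun x _ => tlift_mem_box _)
    (fun y _ => tlift_mem_box _) (fun x hx => ?_) (fun y hy => ?_) (fun x _ => (hg.apply_tlift (x + t)).symm)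
  · have h1 : tcls P (tlift (tcls P (x + t)) - t) = tcls P x := by
      rw [tcls_sub, tcls_tlift, tcls_add, add_sub_cancel_right]
    rw [h1, tlift_tcls_of_mem_box hx]
  · have h1 : tcls P (tlift (tcls P (y - t)) + t) = tcls P y := by
      rw [tcls_add, tcls_tlift, tcls_sub, sub_add_cancel]
    rw [h1, tlift_tcls_of_mem_box hy]

end CellSum

section ByParts

variable {V : Type*} [AddCommGroup V] [Module ℝ V]
variable (B : 𝔸 →ₗ[ℝ] 𝔸 →ₗ[ℝ] V) (S : Subgroup 𝔸ˣ) (P : ℕ) (η : ℝ) (U₀ : Site d → Fin d → 𝔸ˣ)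

/-- `R(u)0 = 0`. [folklore] -/
private theorem conjR_zero' (u : 𝔸ˣ) : conjR u (0 : 𝔸) = 0 := by
  simp [conjR]

/-- the second reading of `Ad`-invariance: `B(a, R(u)b) = B(R(u⁻¹)a, b)` for `u ∈ S`. [folklore] -/
private theorem pair_conjR_right' (hB : ∀ u ∈ S, ∀ a b : 𝔸, B (conjR u a) b = B a (conjR u⁻¹ b)) {u : 𝔸ˣ} (hu : u ∈ S) (a b : 𝔸) :
    B a (conjR u b) = B (conjR u⁻¹ a) b := by
  have h := hB u⁻¹ (S.inv_mem hu) a b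
  rw [inv_inv] at h
  exact h.symm

/-- the flipped pairing is `Ad`-invariant when `B` is. [folklore] -/
private theorem flip_invariant' (hB : ∀ u ∈ S, ∀ a b : 𝔸, B (conjR u a) b = B a (conjR u⁻¹ b)) :
    ∀ u ∈ S, ∀ a b : 𝔸, B.flip (conjR u a) b = B.flip a (conjR u⁻¹ b) := by
  intro u hu a b
  rw [LinearMap.flip_apply, LinearMap.flip_apply]
  exact pair_conjR_right' B S hB hu b a

/-- ★ **SUMMATION BY PARTS ON THE TORUS: `D^{η*}_{U₀,μ}` IS THE `B`-TRANSPOSE OF `D^η_{U₀,μ}` ON THE PERIOD CELL** — for a periodic background whose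
`μ`-bond variables lie in `S`, periodic `f, g`, and every pairing `B` invariant under `S`: `Σ_{x∈[0,P)ᵈ} B(g(x), (D^η_{U₀,μ}f)(x)) =
Σ_{x∈[0,P)ᵈ} B((D^{η*}_{U₀,μ}g)(x), f(x))` (the `ℤᵈ` twin with finite supports is dag-n06-w4's `B9Eq321LandauOrthogonalZd.finsum_pair_covDerivFwd`; here the
boundary term is absent because the cell sum of a periodic function is shift invariant). [cite: Balaban1985RegularSpaces, (1.1)–(1.2) p.76, p.77 («Ω_j = T_η»); Balaban1985BackgroundPropagators, (3.23) p.394, p.391 (the adjoints)] -/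
theorem sum_box_pair_covDerivFwd [NeZero P] (hB : ∀ u ∈ S, ∀ a b : 𝔸, B (conjR u a) b = B a (conjR u⁻¹ b)) (μ : Fin d)
    (hUS : ∀ x : Site d, U₀ x μ ∈ S) (hU : IsPeriodic P U₀) {f g : Site d → 𝔸} (hf : IsPeriodic P f) (hg : IsPeriodic P g) :
    ∑ x ∈ box (d := d) P, B (g x) (covDerivFwd η U₀ μ f x) = ∑ x ∈ box (d := d) P, B (covDeriv η U₀ μ g x) (f x) := by
  -- the two model summands
  set Pf : Site d → V := fun y => B (conjR (U₀ (y - e μ) μ)⁻¹ (η⁻¹ • g (y - e μ))) (f y) with hPf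
  set Q : Site d → V := fun y => B (η⁻¹ • g y) (f y) with hQ
  have hsm : ∀ a b : 𝔸, B a (η⁻¹ • b) = B (η⁻¹ • a) b := fun a b => by
    rw [map_smul, LinearMap.map_smul₂]
  have hL : ∀ x, B (g x) (covDerivFwd η U₀ μ f x) = Pf (x + e μ) - Q x := by
    intro x
    have h1 : B (g x) (η⁻¹ • conjR (U₀ x μ) (f (x + e μ))) = B (conjR (U₀ x μ)⁻¹ (η⁻¹ • g x)) (f (x + e μ)) := by
      rw [← conjR_smul_real, pair_conjR_right' B S hB (hUS x), hsm, conjR_smul_real]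
    simp only [hPf, hQ, covDerivFwd, smul_sub, map_sub, add_sub_cancel_right, h1, hsm]
  have hR : ∀ y, B (covDeriv η U₀ μ g y) (f y) = Pf y - Q y := by
    intro y
    simp only [hPf, hQ, covDeriv, smul_sub, map_sub, LinearMap.sub_apply, conjR_smul_real]
  -- `Pf` is periodic, so its cell sum is shift invariant
  have hPper : IsPeriodic P Pf := by
    intro y m
    simp only [hPf]
    rw [add_sub_right_comm, hg (y - e μ) m, hf y m, show U₀ (y - e μ + (P : ℤ) • m) μ = U₀ (y - e μ) μ from congrFun (hU (y - e μ) m) μ]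
  simp only [hL, hR, Finset.sum_sub_distrib]
  rw [sum_box_shift P hPper (e μ)]

/-- the flipped reading: `Σ_cell B((D^η_{U₀,μ}f)(x), g(x)) = Σ_cell B(f(x), (D^{η*}_{U₀,μ}g)(x))`. [cite: Balaban1985RegularSpaces, (1.1)–(1.2) p.76, p.77] -/
theorem sum_box_pair_covDerivFwd_left [NeZero P] (hB : ∀ u ∈ S, ∀ a b : 𝔸, B (conjR u a) b = B a (conjR u⁻¹ b)) (μ : Fin d)
    (hUS : ∀ x : Site d, U₀ x μ ∈ S) (hU : IsPeriodic P U₀) {f g : Site d → 𝔸} (hf : IsPeriodic P f) (hg : IsPeriodic P g) :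
    ∑ x ∈ box (d := d) P, B (covDerivFwd η U₀ μ f x) (g x) = ∑ x ∈ box (d := d) P, B (f x) (covDeriv η U₀ μ g x) := by
  have h := sum_box_pair_covDerivFwd B.flip S P η U₀ (flip_invariant' B S hB) μ hUS hU hf hg
  simpa only [LinearMap.flip_apply] using h

/-- ★★ **THE ENERGY IDENTITY ON THE TORUS** ([B9] (3.10)'s principal part `D*D`; [B8] (1.55)'s current `J = D^{η*}_{U₀}D^η_{U₀}A`): for a periodic
background with bond variables in `S`, a periodic bond field `A`, and every pairing `B` invariant under `S`,
`Σ_κ Σ_{x∈[0,P)ᵈ} B(A_κ(x), J_κ(x)) = Σ_κ Σ_{ν<κ} Σ_{x∈[0,P)ᵈ} B((D^η_{U₀}A)_{νκ}(x), (D^η_{U₀}A)_{νκ}(x))` — the periodic twin of dag-n06-w4's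
`B9Eq326GaugeTermSquareZd.sum_finsum_pair_Jcur` (same algebra; the cell sums need no support hypotheses).
[cite: Balaban1985BackgroundPropagators, (3.9)–(3.10) p.392, (3.4) p.391; Balaban1985RegularSpaces, (1.2) p.76, (1.55) p.86, p.77 («Ω_j = T_η»)] -/
theorem sum_box_pair_Jcur [NeZero P] (hB : ∀ u ∈ S, ∀ a b : 𝔸, B (conjR u a) b = B a (conjR u⁻¹ b))
    (hUS : ∀ (x : Site d) (κ : Fin d), U₀ x κ ∈ S) (hU : IsPeriodic P U₀) {A : Site d → Fin d → 𝔸} (hA : IsPeriodic P A) :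
    ∑ κ : Fin d, ∑ x ∈ box (d := d) P, B (A x κ) (Jcur η U₀ A κ x) =
      ∑ κ : Fin d, ∑ ν ∈ Finset.Iio κ, ∑ x ∈ box (d := d) P, B (plaqCovDeriv η U₀ A ν κ x) (plaqCovDeriv η U₀ A ν κ x) := by
  classical
  -- fold the plaquette derivative into a letter `F`
  set F : Fin d → Fin d → Site d → 𝔸 := fun μ ν x => plaqCovDeriv η U₀ A μ ν x with hFdef
  have hF : ∀ μ ν x, plaqCovDeriv η U₀ A μ ν x = F μ ν x := fun _ _ _ => rfl
  have hFper : ∀ μ ν, IsPeriodic P (F μ ν) := fun μ ν => isPeriodic_plaqCovDeriv η hU hA μ ν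
  have hAper : ∀ κ, IsPeriodic P fun y => A y κ := fun κ => isPeriodic_apply_dir hA κ
  have hFexp : ∀ μ ν x, F μ ν x = covDerivFwd η U₀ μ (fun y => A y ν) x - covDerivFwd η U₀ ν (fun y => A y μ) x :=
    fun μ ν x => B8Eq146AExpansion.plaqCovDeriv_eq_covDerivFwd η U₀ A μ ν x
  have hJ : ∀ κ x, Jcur η U₀ A κ x =
      ∑ ν ∈ Finset.Iio κ, covDeriv η U₀ ν (F ν κ) x - ∑ ν ∈ Finset.Ioi κ, covDeriv η U₀ ν (F κ ν) x := fun κ x => rfl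
  simp_rw [hF, hJ]
  -- Step 1: move `D^{η*}_ν` across, direction by direction
  have hstep : ∀ κ : Fin d, ∑ x ∈ box (d := d) P, B (A x κ)
      (∑ ν ∈ Finset.Iio κ, covDeriv η U₀ ν (F ν κ) x - ∑ ν ∈ Finset.Ioi κ, covDeriv η U₀ ν (F κ ν) x) =
      ∑ ν ∈ Finset.Iio κ, ∑ x ∈ box (d := d) P, B (covDerivFwd η U₀ ν (fun y => A y κ) x) (F ν κ x) -
      ∑ ν ∈ Finset.Ioi κ, ∑ x ∈ box (d := d) P, B (covDerivFwd η U₀ ν (fun y => A y κ) x) (F κ ν x) := by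
    intro κ
    have h1 : ∀ x, B (A x κ) (∑ ν ∈ Finset.Iio κ, covDeriv η U₀ ν (F ν κ) x - ∑ ν ∈ Finset.Ioi κ, covDeriv η U₀ ν (F κ ν) x) =
        ∑ ν ∈ Finset.Iio κ, B (A x κ) (covDeriv η U₀ ν (F ν κ) x) - ∑ ν ∈ Finset.Ioi κ, B (A x κ) (covDeriv η U₀ ν (F κ ν) x) := by
      intro x
      rw [map_sub, map_sum, map_sum]
    rw [Finset.sum_congr rfl fun x _ => h1 x, Finset.sum_sub_distrib, Finset.sum_comm, Finset.sum_comm (s := box P)]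
    congr 1
    · refine Finset.sum_congr rfl fun ν _ => ?_
      exact (sum_box_pair_covDerivFwd_left B S P η U₀ hB ν (fun x => hUS x ν) hU (hAper κ) (hFper ν κ)).symm
    · refine Finset.sum_congr rfl fun ν _ => ?_
      exact (sum_box_pair_covDerivFwd_left B S P η U₀ hB ν (fun x => hUS x ν) hU (hAper κ) (hFper κ ν)).symm
  -- Step 2: the right side expanded: `B(F_{νκ}, F_{νκ}) = B(∇_νA_κ, F_{νκ}) − B(∇_κA_ν, F_{νκ})`
  have hsq : ∀ ν κ : Fin d, ∑ x ∈ box (d := d) P, B (F ν κ x) (F ν κ x) =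
      ∑ x ∈ box (d := d) P, B (covDerivFwd η U₀ ν (fun y => A y κ) x) (F ν κ x) -
        ∑ x ∈ box (d := d) P, B (covDerivFwd η U₀ κ (fun y => A y ν) x) (F ν κ x) := by
    intro ν κ
    rw [← Finset.sum_sub_distrib]
    refine Finset.sum_congr rfl fun x _ => ?_
    rw [← LinearMap.sub_apply, ← map_sub, ← hFexp]
  -- Step 3: reindex the `ν > κ` block as pairs `κ' < ν'`
  have hswap : ∑ κ : Fin d, ∑ ν ∈ Finset.Ioi κ, ∑ x ∈ box (d := d) P, B (covDerivFwd η U₀ ν (fun y => A y κ) x) (F κ ν x) =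
      ∑ κ : Fin d, ∑ ν ∈ Finset.Iio κ, ∑ x ∈ box (d := d) P, B (covDerivFwd η U₀ κ (fun y => A y ν) x) (F ν κ x) := by
    rw [Finset.sum_sigma' Finset.univ (fun κ => Finset.Ioi κ), Finset.sum_sigma' Finset.univ (fun κ => Finset.Iio κ)]
    refine Finset.sum_bij' (fun p _ => ⟨p.2, p.1⟩) (fun p _ => ⟨p.2, p.1⟩) ?_ ?_ ?_ ?_ ?_
    · rintro ⟨κ, ν⟩ hp
      simp only [Finset.mem_sigma, Finset.mem_univ, Finset.mem_Ioi, true_and] at hp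
      simp only [Finset.mem_sigma, Finset.mem_univ, Finset.mem_Iio, true_and]
      exact hp
    · rintro ⟨κ, ν⟩ hp
      simp only [Finset.mem_sigma, Finset.mem_univ, Finset.mem_Iio, true_and] at hp
      simp only [Finset.mem_sigma, Finset.mem_univ, Finset.mem_Ioi, true_and]
      exact hp
    · rintro ⟨κ, ν⟩ _; rfl
    · rintro ⟨κ, ν⟩ _; rfl
    · rintro ⟨κ, ν⟩ _; rfl
  simp_rw [hstep, hsq]
  simp only [Finset.sum_sub_distrib]
  rw [hswap]

/-- each diagonal term `Re τ(a* a)` is non-negative for a faithful positive trace. [folklore] -/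
private theorem re_trace_star_mul_self_nonneg' (τ : 𝔸 →ₗ[ℂ] ℂ) (hτp : ∀ a : 𝔸, a ≠ 0 → 0 < (τ (star a * a)).re) (a : 𝔸) :
    0 ≤ (τ (star a * a)).re := by
  by_cases ha : a = 0
  · rw [ha, mul_zero, map_zero, Complex.zero_re]
  · exact (hτp a ha).le

/-- ★ **`⟨A, D^{η*}_{U₀}D^η_{U₀}A⟩_{τ,per} = Σ_p Re τ(|(D^η_{U₀}A)(p)|²) ≥ 0` ON THE TORUS** at a periodic unitary background, for a periodic `A` and the pairing
`Re τ(a*b)` of a tracial faithful `τ`: the principal part of (3.10) is positive semi-definite on `T_η`.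
[cite: Balaban1985BackgroundPropagators, (3.10) p.392, Thm 3.11 p.416, p.391; Balaban1985RegularSpaces, (1.55) p.86, p.77] -/
theorem sum_box_re_trace_Jcur_nonneg [NeZero P] (τ : 𝔸 →ₗ[ℂ] ℂ) (hτt : ∀ a b : 𝔸, τ (a * b) = τ (b * a))
    (hτp : ∀ a : 𝔸, a ≠ 0 → 0 < (τ (star a * a)).re) (hUu : ∀ (x : Site d) (κ : Fin d), U₀ x κ ∈ unitaryUnits 𝔸) (hU : IsPeriodic P U₀)
    {A : Site d → Fin d → 𝔸} (hA : IsPeriodic P A) :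
    0 ≤ ∑ κ : Fin d, ∑ x ∈ box (d := d) P, (τ (star (A x κ) * Jcur η U₀ A κ x)).re := by
  let Bτ : 𝔸 →ₗ[ℝ] 𝔸 →ₗ[ℝ] ℝ :=
    LinearMap.mk₂ ℝ (fun a b => (τ (star a * b)).re)
      (fun a₁ a₂ b => by rw [star_add, add_mul, map_add, Complex.add_re])
      (fun c a b => by
        rw [star_smul, star_trivial, smul_mul_assoc, ← Complex.coe_smul, map_smul, smul_eq_mul, smul_eq_mul, Complex.re_ofReal_mul])
      (fun a b₁ b₂ => by rw [mul_add, map_add, Complex.add_re])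
      (fun c a b => by rw [mul_smul_comm, ← Complex.coe_smul, map_smul, smul_eq_mul, smul_eq_mul, Complex.re_ofReal_mul])
  have hB : ∀ u ∈ unitaryUnits 𝔸, ∀ a b : 𝔸, Bτ (conjR u a) b = Bτ a (conjR u⁻¹ b) :=
    fun u hu a b => re_trace_star_pair_invariant τ hτt hu a b
  have key := sum_box_pair_Jcur Bτ (unitaryUnits 𝔸) P η U₀ hB hUu hU hA
  have key' : ∑ κ : Fin d, ∑ x ∈ box (d := d) P, (τ (star (A x κ) * Jcur η U₀ A κ x)).re =
      ∑ κ : Fin d, ∑ ν ∈ Finset.Iio κ, ∑ x ∈ box (d := d) P,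
        (τ (star (plaqCovDeriv η U₀ A ν κ x) * plaqCovDeriv η U₀ A ν κ x)).re := key
  rw [key']
  refine Finset.sum_nonneg fun κ _ => Finset.sum_nonneg fun ν _ => Finset.sum_nonneg fun x _ => ?_
  exact re_trace_star_mul_self_nonneg' τ hτp _

end ByParts

/-! ## §6  A6 ∕ non-vacuity at `Ω 0 = univ` members: the one-level record, where `⟨A, Δ_aA⟩_{τ,per} = ⟨A, D*DA⟩_{τ,per} + η⁻²‖A‖²_{τ,per} > 0` -/

section LevelZero

variable {L : ℕ} (P : ℕ) (ops₀ : ℝ → ZdIdx d L → ℕ → OpsZd d 𝔸) (M : ℝ) (i : ZdIdx d L) (m : ℕ)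

/-- **AT A `Ω 0 = univ` MEMBER THE ONE-LEVEL RECORD'S `Δ_a(U₀) = D*D + η⁻²` MAPS `E_𝔤^per(P)` INTO ITSELF** at every periodic unitary background
(translation covariance of (1.55) + `(D*DA)* = D*D(A*)`, `star_Jcur`). [cite: Balaban1985BackgroundPropagators, (3.26) p.395, (3.10) p.392, p.391; Balaban1985RegularSpaces, (1.55) p.86, p.77] -/
theorem perPreservingAt_opsLevelZero (hΩ : i.Ω 0 = Set.univ) {U₀ : Site d → Fin d → 𝔸ˣ} (hUu : ∀ (x : Site d) (κ : Fin d), U₀ x κ ∈ unitaryUnits 𝔸)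
    (hU : IsPeriodic P U₀) : PerPreservingAt i.η (opsLevelZero ops₀ M i m) P U₀ := by
  rintro A ⟨hAp, hsa⟩
  have hb : ∀ (x : Site d) (μ : Fin d), BondTouches (i.Ω 0) x μ := fun x μ => by rw [hΩ]; exact bondTouches_univ x μ
  have hval : ∀ (x : Site d) (μ : Fin d), deltaAOf i.η (opsLevelZero ops₀ M i m) U₀ A x μ = Jcur i.η U₀ A μ x + (i.η ^ 2)⁻¹ • A x μ := by
    intro x μ
    rw [deltaAOf_opsLevelZero, restrictDom_of A (hb x μ)]
  have hstarA : star A = A := by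
    funext y τ; exact (hsa y τ).star_eq
  refine ⟨fun x m' => ?_, fun y τ => ?_⟩
  · funext μ
    rw [hval, hval, Jcur_add_period i.η hU hAp μ x m', show A (x + (P : ℤ) • m') μ = A x μ from congrFun (hAp x m') μ]
  · rw [hval, IsSelfAdjoint, star_add, star_Jcur hUu A τ y, hstarA, star_smul, star_trivial, (hsa y τ).star_eq]

/-- **`‖A‖²_{τ,per} > 0` FOR A PERIODIC `A ≠ 0`** and a faithful `τ` (`P ≠ 0`): a periodic field vanishing on the cell vanishes.
[cite: Balaban1985BackgroundPropagators, p.390 («|X|² = tr X*X»); Balaban1985RegularSpaces, p.77] -/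
theorem bondPairPer_self_pos [NeZero P] (τ : 𝔸 →ₗ[ℂ] ℂ) (hτp : ∀ a : 𝔸, a ≠ 0 → 0 < (τ (star a * a)).re) {A : Site d → Fin d → 𝔸}
    (hA : IsPeriodic P A) (hA0 : A ≠ 0) : 0 < bondPairPer τ P A A := by
  obtain ⟨x₀, hx₀⟩ := Function.ne_iff.1 hA0
  obtain ⟨μ₀, hx⟩ := Function.ne_iff.1 hx₀
  have hx' : A (tlift (tcls P x₀)) μ₀ ≠ 0 := by
    rw [show A (tlift (tcls P x₀)) μ₀ = A x₀ μ₀ from congrFun (hA.apply_tlift x₀) μ₀]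
    exact hx
  rw [bondPairPer]
  have hterm : ∀ μ, 0 ≤ ∑ x ∈ box (d := d) P, (τ (star (A x μ) * A x μ)).re :=
    fun μ => Finset.sum_nonneg fun x _ => re_trace_star_mul_self_nonneg' τ hτp (A x μ)
  refine lt_of_lt_of_le ?_ (Finset.single_le_sum (fun μ _ => hterm μ) (Finset.mem_univ μ₀))
  exact lt_of_lt_of_le (hτp _ hx')
    (Finset.single_le_sum (fun x _ => re_trace_star_mul_self_nonneg' τ hτp (A x μ₀)) (tlift_mem_box _))

/-- ★ **`⟨A, Δ_a(U₀)A⟩_{τ,per} = ⟨A, D*_{U₀}D_{U₀}A⟩_{τ,per} + η⁻²‖A‖²_{τ,per} > 0` FOR THE ONE-LEVEL RECORD ON THE TORUS**, for every periodic `A ≠ 0`, EVERY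
periodic unitary background `U₀`, at a `Ω 0 = univ` member (`P ≠ 0`, tracial faithful `τ`) — §5's energy positivity plus a positive multiple of
`‖A‖²_{τ,per}`. [cite: Balaban1985BackgroundPropagators, Thm 3.11 p.416 («Δ_a, G are positive definite»), (3.26) p.395; Balaban1985RegularSpaces, p.77] -/
theorem bondPairPer_deltaAOf_opsLevelZero_pos [NeZero P] (τ : 𝔸 →ₗ[ℂ] ℂ) (hτt : ∀ a b : 𝔸, τ (a * b) = τ (b * a))
    (hτp : ∀ a : 𝔸, a ≠ 0 → 0 < (τ (star a * a)).re) (hΩ : i.Ω 0 = Set.univ)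
    {U₀ : Site d → Fin d → 𝔸ˣ} (hUu : ∀ (x : Site d) (κ : Fin d), U₀ x κ ∈ unitaryUnits 𝔸) (hU : IsPeriodic P U₀)
    {A : Site d → Fin d → 𝔸} (hA : IsPeriodic P A) (hA0 : A ≠ 0) :
    0 < bondPairPer τ P A (deltaAOf i.η (opsLevelZero ops₀ M i m) U₀ A) := by
  have hb : ∀ (x : Site d) (μ : Fin d), BondTouches (i.Ω 0) x μ := fun x μ => by rw [hΩ]; exact bondTouches_univ x μ
  have hsplit : bondPairPer τ P A (deltaAOf i.η (opsLevelZero ops₀ M i m) U₀ A) =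
      (∑ μ : Fin d, ∑ x ∈ box (d := d) P, (τ (star (A x μ) * Jcur i.η U₀ A μ x)).re) + (i.η ^ 2)⁻¹ * bondPairPer τ P A A := by
    rw [bondPairPer, bondPairPer, Finset.mul_sum, ← Finset.sum_add_distrib]
    refine Finset.sum_congr rfl fun μ _ => ?_
    rw [Finset.mul_sum, ← Finset.sum_add_distrib]
    refine Finset.sum_congr rfl fun x _ => ?_
    rw [deltaAOf_opsLevelZero, restrictDom_of A (hb x μ), mul_add, map_add, Complex.add_re, mul_smul_comm, ← Complex.coe_smul, map_smul,
      smul_eq_mul, Complex.re_ofReal_mul]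
  rw [hsplit]
  have hη : 0 < (i.η ^ 2)⁻¹ := inv_pos.2 (pow_pos i.hη 2)
  exact add_pos_of_nonneg_of_pos (sum_box_re_trace_Jcur_nonneg P i.η U₀ τ hτt hτp hUu hU hA)
    (mul_pos hη (bondPairPer_self_pos P τ hτp hA hA0))

/-- ★ **A6: `RegularAtHPer` IS INHABITED** — for the one-level record at a `Ω 0 = univ` member, `Δ_a(U₀)` is invertible on `E_𝔤^per(P)` at EVERY periodic
unitary background (`P ≠ 0`, finite-dimensional `𝔸` with a faithful tracial `τ`): §4 applied to §6's positivity.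
[cite: Balaban1985BackgroundPropagators, Thm 3.11 p.416, (3.27) p.395; Balaban1985RegularSpaces, p.77 («Ω_j = T_η»)] -/
theorem regularAtHPer_opsLevelZero [FiniteDimensional ℝ 𝔸] [NeZero P] (τ : 𝔸 →ₗ[ℂ] ℂ) (hτt : ∀ a b : 𝔸, τ (a * b) = τ (b * a))
    (hτp : ∀ a : 𝔸, a ≠ 0 → 0 < (τ (star a * a)).re) (hΩ : i.Ω 0 = Set.univ)
    {U₀ : Site d → Fin d → 𝔸ˣ} (hUu : ∀ (x : Site d) (κ : Fin d), U₀ x κ ∈ unitaryUnits 𝔸) (hU : IsPeriodic P U₀) :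
    RegularAtHPer i.η (opsLevelZero ops₀ M i m) P U₀ := by
  have hlin : LinearOnDomAt i.η (opsLevelZero ops₀ M i m) (Set.univ : Set (Site d)) U₀ := by
    rw [← hΩ]; exact linearOnDomAt_opsLevelZero ops₀ M i m U₀
  exact regularAtHPer_of_bondPairPer_pos τ P hlin (perPreservingAt_opsLevelZero P ops₀ M i m hΩ hUu hU)
    fun A hA hA0 => bondPairPer_deltaAOf_opsLevelZero_pos P ops₀ M i m τ hτt hτp hΩ hUu hU hA.1 hA0

/-- **A6: `RegularInClassAtHPer` IS INHABITED** for the one-level record at every `Ω 0 = univ` member, for EVERY threshold `aI` (the class (1.7) and the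
smallness guard are not even used). [cite: Balaban1985BackgroundPropagators, Thm 3.11 p.416, (3.27) p.395; Balaban1985RegularSpaces, p.77] -/
theorem regularInClassAtHPer_opsLevelZero [FiniteDimensional ℝ 𝔸] [NeZero P] (τ : 𝔸 →ₗ[ℂ] ℂ) (hτt : ∀ a b : 𝔸, τ (a * b) = τ (b * a))
    (hτp : ∀ a : 𝔸, a ≠ 0 → 0 < (τ (star a * a)).re) (hΩ : i.Ω 0 = Set.univ) (aI : ℝ) :
    RegularInClassAtHPer P L (opsLevelZero ops₀) aI M i m :=
  fun _ _ hU₀ hper _ _ => regularAtHPer_opsLevelZero P ops₀ M i m τ hτt hτp hΩ hU₀ hper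

/-- ★ **A6: THE CONCLUSION OF `invAtHIPer_withGopZdHPer` IS INHABITED** — `InvAtHIPer P L (withGopZdHPer P (opsLevelZero ops₀)) aI M i m` at every
`Ω 0 = univ` member, every `aI`, under the `τ`-hypotheses only. [cite: Balaban1985BackgroundPropagators, Thm 3.11 p.416, (3.27) p.395; Balaban1985RegularSpaces, (1.58) p.86, p.77] -/
theorem invAtHIPer_withGopZdHPer_opsLevelZero [FiniteDimensional ℝ 𝔸] [NeZero P] (τ : 𝔸 →ₗ[ℂ] ℂ) (hτt : ∀ a b : 𝔸, τ (a * b) = τ (b * a))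
    (hτp : ∀ a : 𝔸, a ≠ 0 → 0 < (τ (star a * a)).re) (hΩ : i.Ω 0 = Set.univ) (aI : ℝ) :
    InvAtHIPer P L (withGopZdHPer P (opsLevelZero ops₀)) aI M i m :=
  invAtHIPer_withGopZdHPer P (opsLevelZero ops₀) M i m hΩ (regularInClassAtHPer_opsLevelZero P ops₀ M i m τ hτt hτp hΩ aI)

end LevelZero

end Literature.MathematicalPhysics.QuantumFieldTheory.Balaban1983to89.B9Eq327GreenZdHermPer

end
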